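import Mathlib
import Literature.Computability.AlgebraicComplexity.ValiantClasses
import HarnessLib

/-!
# The nest-free (FIFO) and noncrossing (LIFO) matching polynomials `NN_n`, `NC_n`

Topic `Computability/AlgebraicComplexity`; definitions + proved API, no named facts.
Requested by the definition item `defn-nestFreeMatchingPoly` of route
`ValiantsHypothesis/FifoMatching`, whose statement items inline, verbatim, the term
`∑ M : Fin (2 * n) → Fin (2 * n), if ((∀ i, M (M i) = i) ∧ (∀ i, M i ≠ i) ∧ ∀ i j, i < j → j < M j
→ M j < M i → False) then ∏ i : Fin (2 * n), (if i < M i then MvPolynomial.X (i, M i) else 1) else 0`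
(the nest-free matching sum `NN_n`) and its twin with `∀ i j, i < j → j < M i → M i < M j → False`
(the noncrossing matching sum `NC_n`).

**The notions, as printed.**

* Chen–Deng–Du–Stanley–Yan 2007, §1: "A (complete) matching on `[2n] = {1, 2, …, 2n}` is a
  partition of `[2n]` of type `(2, 2, …, 2)`. It can be represented by listing its `n` blocks, as
  `{(i_1, j_1), (i_2, j_2), …, (i_n, j_n)}` where `i_r < j_r` for `1 ≤ r ≤ n`. Two blocks (also
  called arcs) `(i_r, j_r)` and `(i_s, j_s)` form a crossing if `i_r < i_s < j_r < j_s`; they form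
  a nesting if `i_r < i_s < j_s < j_r`. It is well-known that the number of matchings on `[2n]`
  with no crossings (or with no nestings) is given by the `n`-th Catalan number" (noncrossing:
  Stanley EC2, Ex. 6.19(o); nonnesting: Ex. 6.19(ww), "in which the blocks of the matching are the
  columns of the standard Young tableaux of shape `(n, n)`"). The same two statistics are
  Blitvić 2012, Def. 1 (pair partitions `𝒱 = {(w_1, z_1), …, (w_n, z_n)} ∈ 𝒫₂(2n)`; "cross" if
  `w_i < w_j < z_i < z_j`, "nest" if `w_i < w_j < z_j < z_i`).
* Grytczuk–Pawlik–Ruciński 2025, §2.1: "A nest in an ordered graph consists of a pair of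
  disjoint edges `e` and `f` with `min e < min f` and `max e > max f`. An ordered graph is
  nest-free if no pair of its edges forms a nest"; p. 8 and Prop. 1: the twins
  `X = w_{i_1} ⋯ w_{i_t}`, `Y = w_{j_1} ⋯ w_{j_t}` (`i_1 < ⋯ < i_t`, `j_1 < ⋯ < j_t`, `i_h < j_h`,
  disjoint) of a shuffle square give the matching `{i_1, j_1}, …, {i_t, j_t}`, and "clearly,
  there are no nests in `M`" — nest-free perfect matchings are the FIFO (queue) pairings
  "`h`-th letter of `X` with `h`-th letter of `Y`".
* Blitvić 2012, Lemma 9 (the `(q,t)`-Wick formula):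
  `φ_{q,t}(s(h_1) ⋯ s(h_{2n})) = Σ_{𝒱 ∈ 𝒫₂(2n)} q^{cross 𝒱} t^{nest 𝒱} Π_i ⟨h_{w_i}, h_{z_i}⟩`;
  with generic "covariances" `x_{w z}` its `(q, t) = (1, 0)` corner is the sum over nonnesting
  pairings `NN_n` and its `(0, 1)` corner the sum over noncrossing pairings `NC_n` defined here.

**Encoding (the route's).** A matching of the ordered set `Fin m` is a function
`M : Fin m → Fin m`; it is a perfect matching iff `M` is a fixed-point-free involution
(`∀ i, M (M i) = i`, `∀ i, M i ≠ i`), its arcs are the pairs `(i, M i)` with `i < M i` (`i` an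
*opener*, `M i` a *closer*), a nesting is `i < j < M j < M i` and a crossing is
`i < j < M i < M j`. The arc monomial of `M` is `Π_{i < M i} x_(i, M i)`, a monomial in the `m²`
variables `x_(i, j)`, `(i, j) ∈ Fin m × Fin m` (only the variables above the diagonal occur).

## Contents

* Finsets `perfectMatchings m ⊇ nestFreeMatchings m, noncrossingMatchings m` of functions
  `Fin m → Fin m` (literally the route's `if`-conditions), `openers M`, and the counting lemma
  `two_mul_card_openers` (`2 · #openers = m` for a perfect matching; `card_openers`: `n` openers
  on `Fin (2 n)`);
* `arcMonomial k M = Π_i (if i < M i then X (i, M i) else 1)` (the route's product, verbatim),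
  its exponent vector `arcExponent M = Σ_{i opener} δ_(i, M i)`, `arcMonomial_eq_monomial`,
  `arcExponent_apply`, `arcExponent_injOn` (a perfect matching is determined by its arc set),
  `map_arcMonomial`, `eval_arcMonomial`, `arcMonomial_isHomogeneous`;
* generic API for arc-weighted generating polynomials `Σ_{M ∈ S} arcMonomial k M` of a family `S`
  of matchings: `coeff_sum_arcMonomial` (`0/1` coefficients), `support_sum_arcMonomial`,
  `card_support_sum_arcMonomial` (`= #S`), `eval_indicator_sum_arcMonomial` (at the `0/1` point of
  an edge set `A` the value is the number of `M ∈ S` all of whose arcs lie in `A`),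
  `sum_arcMonomial_isHomogeneous`;
* `nestFreeMatchingPoly n k = NN_n` and `noncrossingMatchingPoly n k = NC_n`, each *defined* by
  the route's inlined term (`nestFreeMatchingPoly_eq_sum_ite : … = <route term> := rfl`), with
  `…_eq_sum_arcMonomial` (sum over `nestFreeMatchings (2 n)` / `noncrossingMatchings (2 n)`),
  `map_…` (change of scalars along any semiring hom, e.g. `ℝ≥0 → ℂ`), `coeff_…`,
  `coeff_…_eq_zero_or_eq_one`, `support_…`, `card_support_…` (`= #nestFreeMatchings (2 n)`),
  `eval_indicator_…` (counts the nest-free / noncrossing perfect matchings of an ordered graph),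
  `…_isHomogeneous` (degree `n`), `totalDegree_…_le`, and `isPFamily_…` (`4 n²` variables,
  degree `≤ n`: a p-family in the sense of Bürgisser 2000, Def. 2.3).

## Design notes / what is NOT here

* `import Mathlib`, as in the route file, so that the `Decidable` instances hidden in the two
  `if`s are found by the same instance search: the bridge to the inlined items is `rfl`.
* Argument order `(n) (k)`, ring explicit and last, as in `perPoly n k`; `NN_n` lives in
  `MvPolynomial (Fin (2 * n) × Fin (2 * n)) k` exactly as inlined (not `Fin m` for odd `m`).
* The combinatorial vocabulary (`perfectMatchings`, `openers`, `arcExponent`, …) is on `Fin m` for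
  any `m`; for odd `m` there is no perfect matching (`two_mul_card_openers`).
* NOT here (follow-ups of the same item): `#nestFreeMatchings (2 n) = #noncrossingMatchings (2 n)
  = catalan n` (Chen–Deng–Du–Stanley–Yan 2007, §1) and the FIFO description of `NN_n` as the sum
  over pairs of complementary increasing sequences `p, q : Fin n → Fin (2 n)` with `p a < q a`
  of `Π_a x_(p a, q a)` (two-row standard Young tableaux); the interval recursion of `NC`;
  anything about circuits (`NN ∉ VP`, `NC ∈ VP` are route items, not literature).
* Mathlib has no matchings-of-an-ordered-set / crossings / nestings (searched `nonnesting`,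
  `noncrossing`, `nestFree`, `hafnian`, `matchingPoly`: only the tree's bipartite
  `Literature.Combinatorics.SimpleGraph.perfectMatchingPoly` = permanent of the Edmonds matrix,
  a different object — bipartite matchings as permutations — whose API this file mirrors).

## References

* W. Y. C. Chen, E. Y. P. Deng, R. R. X. Du, R. P. Stanley, C. H. Yan, *Crossings and nestings of
  matchings and partitions*, Trans. AMS 359 (2007) 1555–1575, §1. [ChenDengDuStanleyYan2007]
* J. Grytczuk, B. Pawlik, A. Ruciński, *Shuffle squares and ordered nest-free graphs*,
  arXiv:2503.22043 (2025), §2.1 and Prop. 1. [GrytczukPawlikRucinski2025]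
* N. Blitvić, *The (q,t)-Gaussian process*, J. Funct. Anal. 263 (2012) 3270–3305, Def. 1 and
  Lemma 9. [Blitvic2012]
* P. Bürgisser, *Completeness and Reduction in Algebraic Complexity Theory*, Springer 2000,
  Def. 2.3 (p-families). [Burgisser2000]
-/

noncomputable section

open MvPolynomial Finset

namespace Literature.Computability.AlgebraicComplexity

/-! ### Matchings of the ordered set `Fin m` as fixed-point-free involutions -/

section Matchings

variable {m : ℕ}

/-- The **perfect matchings** of the ordered set `Fin m`, encoded (as in route `FifoMatching`) as
the fixed-point-free involutions `M : Fin m → Fin m` (`M (M i) = i`, `M i ≠ i`); the blocks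
(arcs) of `M` are the pairs `{i, M i}` (Chen–Deng–Du–Stanley–Yan 2007, §1: a complete matching on
`[2n]` is a partition of type `(2, …, 2)`, "also … a fixed-point-free involution").
[cite: ChenDengDuStanleyYan2007, §1] -/
def perfectMatchings (m : ℕ) : Finset (Fin m → Fin m) :=
  univ.filter fun M => (∀ i, M (M i) = i) ∧ ∀ i, M i ≠ i

/-- The **nest-free (nonnesting) perfect matchings** of `Fin m`: perfect matchings with no two
arcs `i < j < M j < M i` (Chen–Deng–Du–Stanley–Yan 2007, §1: arcs `(i_r, j_r)`, `(i_s, j_s)`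
"form a nesting if `i_r < i_s < j_s < j_r`"; Grytczuk–Pawlik–Ruciński 2025, §2.1: "nest-free").
The condition is literally the one inlined in route `FifoMatching`. [cite: ChenDengDuStanleyYan2007, §1] -/
def nestFreeMatchings (m : ℕ) : Finset (Fin m → Fin m) :=
  univ.filter fun M =>
    (∀ i, M (M i) = i) ∧ (∀ i, M i ≠ i) ∧ ∀ i j, i < j → j < M j → M j < M i → False

/-- The **noncrossing perfect matchings** of `Fin m`: perfect matchings with no two arcs
`i < j < M i < M j` (Chen–Deng–Du–Stanley–Yan 2007, §1: arcs "form a crossing if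
`i_r < i_s < j_r < j_s`"; Blitvić 2012, Def. 1). The condition is literally the one inlined in
route `FifoMatching` (item `NCInVP`). [cite: ChenDengDuStanleyYan2007, §1] -/
def noncrossingMatchings (m : ℕ) : Finset (Fin m → Fin m) :=
  univ.filter fun M =>
    (∀ i, M (M i) = i) ∧ (∀ i, M i ≠ i) ∧ ∀ i j, i < j → j < M i → M i < M j → False

/-- Membership in `perfectMatchings m`: `M` is a fixed-point-free involution. [folklore] -/
theorem mem_perfectMatchings {M : Fin m → Fin m} :
    M ∈ perfectMatchings m ↔ (∀ i, M (M i) = i) ∧ ∀ i, M i ≠ i :=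
  mem_filter.trans (and_iff_right (mem_univ _))

/-- Membership in `nestFreeMatchings m`: a perfect matching with no nesting `i < j < M j < M i`.
[folklore] -/
theorem mem_nestFreeMatchings {M : Fin m → Fin m} :
    M ∈ nestFreeMatchings m ↔
      M ∈ perfectMatchings m ∧ ∀ i j, i < j → j < M j → M j < M i → False := by
  rw [mem_perfectMatchings, and_assoc]
  exact mem_filter.trans (and_iff_right (mem_univ _))

/-- Membership in `noncrossingMatchings m`: a perfect matching with no crossing
`i < j < M i < M j`. [folklore] -/
theorem mem_noncrossingMatchings {M : Fin m → Fin m} :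
    M ∈ noncrossingMatchings m ↔
      M ∈ perfectMatchings m ∧ ∀ i j, i < j → j < M i → M i < M j → False := by
  rw [mem_perfectMatchings, and_assoc]
  exact mem_filter.trans (and_iff_right (mem_univ _))

/-- Nest-free perfect matchings are perfect matchings. [folklore] -/
theorem nestFreeMatchings_subset_perfectMatchings :
    nestFreeMatchings m ⊆ perfectMatchings m :=
  fun _ hM => (mem_nestFreeMatchings.1 hM).1

/-- Noncrossing perfect matchings are perfect matchings. [folklore] -/
theorem noncrossingMatchings_subset_perfectMatchings :
    noncrossingMatchings m ⊆ perfectMatchings m :=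
  fun _ hM => (mem_noncrossingMatchings.1 hM).1

/-- The **openers** (left endpoints of arcs) of a matching `M` of `Fin m`: the points `i` with
`i < M i`; the arcs of `M` are the pairs `(i, M i)`, `i` an opener
(Chen–Deng–Du–Stanley–Yan 2007, §1: "`i` is the lefthand endpoint"). [folklore] -/
def openers (M : Fin m → Fin m) : Finset (Fin m) :=
  univ.filter fun i => i < M i

/-- `i` is an opener of `M` iff `i < M i`. [folklore] -/
@[simp]
theorem mem_openers {M : Fin m → Fin m} {i : Fin m} : i ∈ openers M ↔ i < M i :=
  mem_filter.trans (and_iff_right (mem_univ _))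

/-- In a perfect matching `M` of `Fin m`, `M` maps the openers bijectively onto the closers
(the points `i` with `M i < i`). [folklore] -/
theorem image_openers {M : Fin m → Fin m} (hM : M ∈ perfectMatchings m) :
    (openers M).image M = univ.filter fun i => M i < i := by
  obtain ⟨hinv, -⟩ := mem_perfectMatchings.1 hM
  ext j
  simp only [mem_image, mem_openers, mem_filter, mem_univ, true_and]
  constructor
  · rintro ⟨i, hi, rfl⟩
    rwa [hinv]
  · intro hj
    exact ⟨M j, by rwa [hinv], hinv j⟩

/-- A perfect matching of `Fin m` has `m / 2` arcs: twice the number of openers is `m` (so `m`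
is even). [folklore] -/
theorem two_mul_card_openers {M : Fin m → Fin m} (hM : M ∈ perfectMatchings m) :
    2 * (openers M).card = m := by
  obtain ⟨hinv, hfp⟩ := mem_perfectMatchings.1 hM
  have hinj : Function.Injective M := Function.Involutive.injective hinv
  have hC : (univ.filter fun i => M i < i).card = (openers M).card := by
    rw [← image_openers hM, card_image_of_injective _ hinj]
  have hneg : (univ.filter fun i => ¬ i < M i) = univ.filter fun i => M i < i := by
    refine filter_congr fun i _ => ?_
    constructor
    · exact fun h => lt_of_le_of_ne (not_lt.1 h) (hfp i)
    · exact fun h => not_lt.2 h.le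
  have hsum := card_filter_add_card_filter_not (s := (univ : Finset (Fin m))) (fun i => i < M i)
  rw [hneg, hC, card_univ, Fintype.card_fin] at hsum
  change (openers M).card + (openers M).card = m at hsum
  omega

/-- A perfect matching of `Fin (2 n)` has exactly `n` openers (arcs). [folklore] -/
theorem card_openers {n : ℕ} {M : Fin (2 * n) → Fin (2 * n)}
    (hM : M ∈ perfectMatchings (2 * n)) : (openers M).card = n := by
  have := two_mul_card_openers hM
  omega

/-! ### The arc monomial of a matching -/

variable (k : Type*) [CommSemiring k]

/-- The **arc monomial** `x^M = Π_{i < M i} x_(i, M i)` of a matching `M` of `Fin m`, written,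
as in route `FifoMatching`, as the product over all `i` of `x_(i, M i)` if `i` is an opener and
`1` otherwise (Blitvić 2012, Lemma 9: the weight `Π_i ⟨h_{w_i}, h_{z_i}⟩` of a pairing
`{(w_i, z_i)}`). [folklore] -/
def arcMonomial (M : Fin m → Fin m) : MvPolynomial (Fin m × Fin m) k :=
  ∏ i : Fin m, if i < M i then X (i, M i) else 1

/-- The **exponent vector** `Σ_{i opener} δ_(i, M i) : Fin m × Fin m →₀ ℕ` of the arc monomial of
`M` — the indicator of the arc set `{(i, M i) : i < M i}`. [folklore] -/
def arcExponent (M : Fin m → Fin m) : (Fin m × Fin m) →₀ ℕ :=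
  ∑ i ∈ openers M, Finsupp.single (i, M i) 1

variable {k}

/-- The arc monomial is the product of the arc variables over the openers. [folklore] -/
theorem arcMonomial_eq_prod_openers (M : Fin m → Fin m) :
    arcMonomial k M = ∏ i ∈ openers M, X (i, M i) := by
  rw [arcMonomial, openers, prod_filter]

/-- The arc monomial is the monomial `x^{arcExponent M}` with coefficient `1`. [folklore] -/
theorem arcMonomial_eq_monomial (M : Fin m → Fin m) :
    arcMonomial k M = monomial (arcExponent M) 1 := by
  rw [arcMonomial_eq_prod_openers, arcExponent, monomial_sum_one]
  rfl

/-- Values of the exponent vector: `arcExponent M (i, j) = 1` if `(i, j)` is an arc of `M`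
(`i < M i = j`) and `0` otherwise. [folklore] -/
theorem arcExponent_apply (M : Fin m → Fin m) (i j : Fin m) :
    arcExponent M (i, j) = if i < M i ∧ M i = j then 1 else 0 := by
  rw [arcExponent, Finsupp.finsetSum_apply]
  simp only [Finsupp.single_apply]
  split_ifs with h
  · rw [sum_eq_single_of_mem i (mem_openers.2 h.1)]
    · rw [if_pos (by rw [h.2])]
    · intro b _ hb
      exact if_neg fun e => hb (Prod.ext_iff.1 e).1
  · refine sum_eq_zero fun b hb => if_neg fun e => h ?_
    obtain ⟨rfl, rfl⟩ := Prod.ext_iff.1 e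
    exact ⟨mem_openers.1 hb, rfl⟩

/-- **A perfect matching is determined by its arc set:** `M ↦ arcExponent M` is injective on the
perfect matchings of `Fin m`. [folklore] -/
theorem arcExponent_injOn :
    Set.InjOn (arcExponent (m := m)) (perfectMatchings m : Set (Fin m → Fin m)) := by
  intro M hM M' hM' h
  obtain ⟨hinv, hfp⟩ := mem_perfectMatchings.1 (mem_coe.1 hM)
  obtain ⟨hinv', -⟩ := mem_perfectMatchings.1 (mem_coe.1 hM')
  have key : ∀ i, i < M i → M' i = M i := fun i hi => by
    have e := congrArg (fun d => d (i, M i)) h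
    simp only [arcExponent_apply, hi, true_and, if_true] at e
    by_contra hne
    rw [if_neg fun h' => hne h'.2] at e
    exact one_ne_zero e
  funext i
  rcases lt_or_gt_of_ne (hfp i).symm with hi | hi
  · exact (key i hi).symm
  · have hj : M i < M (M i) := by rwa [hinv]
    have h1 := key (M i) hj
    rw [hinv] at h1
    calc M i = M' (M' (M i)) := (hinv' (M i)).symm
      _ = M' i := by rw [h1]

/-- Change of scalars: the arc monomial over `k` maps to the arc monomial over `k'`. [folklore] -/
theorem map_arcMonomial {k' : Type*} [CommSemiring k'] (f : k →+* k') (M : Fin m → Fin m) :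
    map f (arcMonomial k M) = arcMonomial k' M := by
  rw [arcMonomial, arcMonomial, map_prod]
  refine prod_congr rfl fun i _ => ?_
  split_ifs
  · exact map_X f _
  · exact map_one _

/-- Evaluating the arc monomial at arc weights `w` gives the product of the weights of the arcs.
[folklore] -/
theorem eval_arcMonomial (w : Fin m × Fin m → k) (M : Fin m → Fin m) :
    eval w (arcMonomial k M) = ∏ i ∈ openers M, w (i, M i) := by
  rw [arcMonomial_eq_prod_openers, map_prod]
  simp only [eval_X]

/-- The arc monomial of `M` is homogeneous of degree the number of arcs (openers) of `M`.
[folklore] -/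
theorem arcMonomial_isHomogeneous (M : Fin m → Fin m) :
    (arcMonomial k M).IsHomogeneous (openers M).card := by
  rw [arcMonomial_eq_prod_openers]
  have := IsHomogeneous.prod (φ := fun i : Fin m => (X (i, M i) : MvPolynomial _ k)) (openers M)
    (fun _ => 1) fun i _ => isHomogeneous_X k _
  simpa using this

/-! ### Arc-weighted generating polynomials `Σ_{M ∈ S} x^M` of a family of matchings -/

/-- Change of scalars for `Σ_{M ∈ S} x^M`. [folklore] -/
theorem map_sum_arcMonomial {k' : Type*} [CommSemiring k'] (f : k →+* k')
    (S : Finset (Fin m → Fin m)) :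
    map f (∑ M ∈ S, arcMonomial k M) = ∑ M ∈ S, arcMonomial k' M := by
  rw [map_sum]
  exact sum_congr rfl fun M _ => map_arcMonomial f M

/-- **`0/1` coefficients.** For a family `S` of perfect matchings, the coefficient of `x^d` in
`Σ_{M ∈ S} x^M` is `1` if `d` is the arc set of some `M ∈ S` and `0` otherwise (distinct perfect
matchings have distinct arc sets, `arcExponent_injOn`). [folklore] -/
theorem coeff_sum_arcMonomial {S : Finset (Fin m → Fin m)} (hS : S ⊆ perfectMatchings m)
    (d : (Fin m × Fin m) →₀ ℕ) :
    coeff d (∑ M ∈ S, arcMonomial k M) = if ∃ M ∈ S, arcExponent M = d then 1 else 0 := by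
  rw [coeff_sum]
  simp_rw [arcMonomial_eq_monomial, coeff_monomial]
  split_ifs with h
  · obtain ⟨M, hM, hd⟩ := h
    rw [sum_eq_single_of_mem M hM, if_pos hd]
    intro M' hM' hne
    exact if_neg fun hd' => hne (arcExponent_injOn (hS hM') (hS hM) (hd'.trans hd.symm))
  · exact sum_eq_zero fun M hM => if_neg fun hd => h ⟨M, hM, hd⟩

/-- Every coefficient of `Σ_{M ∈ S} x^M` (`S` a family of perfect matchings) is `0` or `1`.
[folklore] -/
theorem coeff_sum_arcMonomial_eq_zero_or_eq_one {S : Finset (Fin m → Fin m)}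
    (hS : S ⊆ perfectMatchings m) (d : (Fin m × Fin m) →₀ ℕ) :
    coeff d (∑ M ∈ S, arcMonomial k M) = 0 ∨ coeff d (∑ M ∈ S, arcMonomial k M) = 1 := by
  rw [coeff_sum_arcMonomial hS]
  split_ifs
  · exact Or.inr rfl
  · exact Or.inl rfl

/-- Over a nontrivial semiring the support of `Σ_{M ∈ S} x^M` (`S` a family of perfect matchings)
is the set of arc sets of the members of `S`. [folklore] -/
theorem support_sum_arcMonomial [Nontrivial k] {S : Finset (Fin m → Fin m)}
    (hS : S ⊆ perfectMatchings m) :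
    (∑ M ∈ S, arcMonomial k M).support = S.image arcExponent := by
  ext d
  rw [mem_support_iff, coeff_sum_arcMonomial hS, mem_image]
  split_ifs with h
  · simp only [ne_eq, one_ne_zero, not_false_eq_true, true_iff]
    exact h
  · simp only [ne_eq, not_true_eq_false, false_iff]
    exact h

/-- Over a nontrivial semiring, `Σ_{M ∈ S} x^M` (`S` a family of perfect matchings) has exactly
`#S` monomials. [folklore] -/
theorem card_support_sum_arcMonomial [Nontrivial k] {S : Finset (Fin m → Fin m)}
    (hS : S ⊆ perfectMatchings m) :
    (∑ M ∈ S, arcMonomial k M).support.card = S.card := by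
  rw [support_sum_arcMonomial hS, card_image_of_injOn fun M hM M' hM' h =>
    arcExponent_injOn (hS hM) (hS hM') h]

/-- Evaluating `Σ_{M ∈ S} x^M` at arc weights `w`. [folklore] -/
theorem eval_sum_arcMonomial (w : Fin m × Fin m → k) (S : Finset (Fin m → Fin m)) :
    eval w (∑ M ∈ S, arcMonomial k M) = ∑ M ∈ S, ∏ i ∈ openers M, w (i, M i) := by
  rw [map_sum]
  exact sum_congr rfl fun M _ => eval_arcMonomial w M

/-- **Counting matchings of an ordered graph.** At the `0/1` point of an edge set
`A ⊆ Fin m × Fin m` (edges written `(opener, closer)`), `Σ_{M ∈ S} x^M` evaluates to the number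
of members of `S` all of whose arcs lie in `A`, i.e. the number of `S`-matchings of the ordered
graph `A`. [folklore] -/
theorem eval_indicator_sum_arcMonomial (A : Finset (Fin m × Fin m)) (S : Finset (Fin m → Fin m)) :
    eval (fun e => if e ∈ A then (1 : k) else 0) (∑ M ∈ S, arcMonomial k M) =
      ((S.filter fun M => ∀ i ∈ openers M, (i, M i) ∈ A).card : k) := by
  rw [eval_sum_arcMonomial, natCast_card_filter]
  refine sum_congr rfl fun M _ => ?_
  exact prod_boole.trans (ite_congr rfl (fun _ => rfl) fun _ => rfl)

/-- If every member of `S` has `d` arcs, `Σ_{M ∈ S} x^M` is homogeneous of degree `d`. [folklore] -/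
theorem sum_arcMonomial_isHomogeneous {S : Finset (Fin m → Fin m)} {d : ℕ}
    (h : ∀ M ∈ S, (openers M).card = d) :
    (∑ M ∈ S, arcMonomial k M).IsHomogeneous d :=
  IsHomogeneous.sum S _ d fun M hM => h M hM ▸ arcMonomial_isHomogeneous M

end Matchings

/-! ### The polynomials `NN_n` and `NC_n` -/

section Defs

variable (n : ℕ) (k : Type*) [CommSemiring k]

/-- The **nest-free (nonnesting, FIFO) matching polynomial**
`NN_n = Σ_{M nest-free perfect matching of Fin (2n)} Π_{i < M i} x_(i, M i)` in the `4 n²`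
variables `x_(i, j)`, `(i, j) ∈ Fin (2n) × Fin (2n)`: the arc-weighted generating polynomial of the
nonnesting matchings of `[2n]` (Chen–Deng–Du–Stanley–Yan 2007, §1; the `(q, t) = (1, 0)` corner
of Blitvić's `(q,t)`-Wick formula, Blitvić 2012, Lemma 9, with generic covariances), written —
verbatim as inlined in route `ValiantsHypothesis/FifoMatching` — as a sum over all maps
`M : Fin (2n) → Fin (2n)` with an `if` selecting the nest-free fixed-point-free involutions.
[cite: ChenDengDuStanleyYan2007, §1] -/
def nestFreeMatchingPoly : MvPolynomial (Fin (2 * n) × Fin (2 * n)) k :=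
  ∑ M : Fin (2 * n) → Fin (2 * n),
    if ((∀ i, M (M i) = i) ∧ (∀ i, M i ≠ i) ∧ ∀ i j, i < j → j < M j → M j < M i → False) then
      ∏ i : Fin (2 * n), (if i < M i then MvPolynomial.X (i, M i) else 1)
    else (0 : MvPolynomial (Fin (2 * n) × Fin (2 * n)) k)

/-- The **noncrossing (LIFO) matching polynomial**
`NC_n = Σ_{M noncrossing perfect matching of Fin (2n)} Π_{i < M i} x_(i, M i)` in the `4 n²`
variables `x_(i, j)`: the arc-weighted generating polynomial of the noncrossing matchings of
`[2n]` (Chen–Deng–Du–Stanley–Yan 2007, §1; the `(q, t) = (0, 1)` corner of Blitvić 2012,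
Lemma 9), written verbatim as inlined in route `ValiantsHypothesis/FifoMatching` (item `NCInVP`).
[cite: ChenDengDuStanleyYan2007, §1] -/
def noncrossingMatchingPoly : MvPolynomial (Fin (2 * n) × Fin (2 * n)) k :=
  ∑ M : Fin (2 * n) → Fin (2 * n),
    if ((∀ i, M (M i) = i) ∧ (∀ i, M i ≠ i) ∧ ∀ i j, i < j → j < M i → M i < M j → False) then
      ∏ i : Fin (2 * n), (if i < M i then MvPolynomial.X (i, M i) else 1)
    else (0 : MvPolynomial (Fin (2 * n) × Fin (2 * n)) k)

end Defs

section API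

variable (n : ℕ) (k : Type*) [CommSemiring k]

/-- Unfolding: `NN_n` is verbatim the term inlined in the items of route
`ValiantsHypothesis/FifoMatching` (`NNNotVP`, `PerProjectsToNN`, `NNMonotoneHard`, `NNInVNP`,
`TimeCutFoolingSet`). [folklore] -/
theorem nestFreeMatchingPoly_eq_sum_ite :
    nestFreeMatchingPoly n k =
      ∑ M : Fin (2 * n) → Fin (2 * n),
        if ((∀ i, M (M i) = i) ∧ (∀ i, M i ≠ i) ∧ ∀ i j, i < j → j < M j → M j < M i → False) then
          ∏ i : Fin (2 * n), (if i < M i then MvPolynomial.X (i, M i) else 1)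
        else (0 : MvPolynomial (Fin (2 * n) × Fin (2 * n)) k) :=
  rfl

/-- Unfolding: `NC_n` is verbatim the term inlined in item `NCInVP` of route
`ValiantsHypothesis/FifoMatching`. [folklore] -/
theorem noncrossingMatchingPoly_eq_sum_ite :
    noncrossingMatchingPoly n k =
      ∑ M : Fin (2 * n) → Fin (2 * n),
        if ((∀ i, M (M i) = i) ∧ (∀ i, M i ≠ i) ∧ ∀ i j, i < j → j < M i → M i < M j → False) then
          ∏ i : Fin (2 * n), (if i < M i then MvPolynomial.X (i, M i) else 1)
        else (0 : MvPolynomial (Fin (2 * n) × Fin (2 * n)) k) :=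
  rfl

/-- `NN_n` is the sum of the arc monomials of the nest-free perfect matchings of `Fin (2n)`.
[folklore] -/
theorem nestFreeMatchingPoly_eq_sum_arcMonomial :
    nestFreeMatchingPoly n k = ∑ M ∈ nestFreeMatchings (2 * n), arcMonomial k M := by
  rw [nestFreeMatchingPoly, nestFreeMatchings, sum_filter]
  rfl

/-- `NC_n` is the sum of the arc monomials of the noncrossing perfect matchings of `Fin (2n)`.
[folklore] -/
theorem noncrossingMatchingPoly_eq_sum_arcMonomial :
    noncrossingMatchingPoly n k = ∑ M ∈ noncrossingMatchings (2 * n), arcMonomial k M := by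
  rw [noncrossingMatchingPoly, noncrossingMatchings, sum_filter]
  rfl

variable {k}

/-- Change of scalars: `NN_n` over `k` maps to `NN_n` over `k'` along any semiring homomorphism
(e.g. `ℝ≥0 → ℂ`: a monotone circuit for `NN_n` over `ℝ≥0` computes `NN_n` over `ℂ`). [folklore] -/
theorem map_nestFreeMatchingPoly {k' : Type*} [CommSemiring k'] (f : k →+* k') :
    map f (nestFreeMatchingPoly n k) = nestFreeMatchingPoly n k' := by
  rw [nestFreeMatchingPoly_eq_sum_arcMonomial, nestFreeMatchingPoly_eq_sum_arcMonomial,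
    map_sum_arcMonomial]

/-- Change of scalars for `NC_n`. [folklore] -/
theorem map_noncrossingMatchingPoly {k' : Type*} [CommSemiring k'] (f : k →+* k') :
    map f (noncrossingMatchingPoly n k) = noncrossingMatchingPoly n k' := by
  rw [noncrossingMatchingPoly_eq_sum_arcMonomial, noncrossingMatchingPoly_eq_sum_arcMonomial,
    map_sum_arcMonomial]

/-- **The coefficients of `NN_n` are `0/1`:** the coefficient of `x^d` is `1` if `d` is the arc
set of a nest-free perfect matching of `Fin (2n)` and `0` otherwise. [folklore] -/
theorem coeff_nestFreeMatchingPoly (d : (Fin (2 * n) × Fin (2 * n)) →₀ ℕ) :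
    coeff d (nestFreeMatchingPoly n k) =
      if ∃ M ∈ nestFreeMatchings (2 * n), arcExponent M = d then 1 else 0 := by
  rw [nestFreeMatchingPoly_eq_sum_arcMonomial,
    coeff_sum_arcMonomial nestFreeMatchings_subset_perfectMatchings]

/-- **The coefficients of `NC_n` are `0/1`.** [folklore] -/
theorem coeff_noncrossingMatchingPoly (d : (Fin (2 * n) × Fin (2 * n)) →₀ ℕ) :
    coeff d (noncrossingMatchingPoly n k) =
      if ∃ M ∈ noncrossingMatchings (2 * n), arcExponent M = d then 1 else 0 := by
  rw [noncrossingMatchingPoly_eq_sum_arcMonomial,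
    coeff_sum_arcMonomial noncrossingMatchings_subset_perfectMatchings]

/-- Every coefficient of `NN_n` is `0` or `1` (the hypothesis of Valiant's criterion). [folklore] -/
theorem coeff_nestFreeMatchingPoly_eq_zero_or_eq_one (d : (Fin (2 * n) × Fin (2 * n)) →₀ ℕ) :
    coeff d (nestFreeMatchingPoly n k) = 0 ∨ coeff d (nestFreeMatchingPoly n k) = 1 := by
  rw [nestFreeMatchingPoly_eq_sum_arcMonomial]
  exact coeff_sum_arcMonomial_eq_zero_or_eq_one nestFreeMatchings_subset_perfectMatchings d

/-- Every coefficient of `NC_n` is `0` or `1`. [folklore] -/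
theorem coeff_noncrossingMatchingPoly_eq_zero_or_eq_one (d : (Fin (2 * n) × Fin (2 * n)) →₀ ℕ) :
    coeff d (noncrossingMatchingPoly n k) = 0 ∨ coeff d (noncrossingMatchingPoly n k) = 1 := by
  rw [noncrossingMatchingPoly_eq_sum_arcMonomial]
  exact coeff_sum_arcMonomial_eq_zero_or_eq_one noncrossingMatchings_subset_perfectMatchings d

/-- The support of `NN_n` (nontrivial scalars) is the set of arc sets of the nest-free perfect
matchings of `Fin (2n)`. [folklore] -/
theorem support_nestFreeMatchingPoly [Nontrivial k] :
    (nestFreeMatchingPoly n k).support = (nestFreeMatchings (2 * n)).image arcExponent := by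
  rw [nestFreeMatchingPoly_eq_sum_arcMonomial,
    support_sum_arcMonomial nestFreeMatchings_subset_perfectMatchings]

/-- The support of `NC_n` (nontrivial scalars). [folklore] -/
theorem support_noncrossingMatchingPoly [Nontrivial k] :
    (noncrossingMatchingPoly n k).support = (noncrossingMatchings (2 * n)).image arcExponent := by
  rw [noncrossingMatchingPoly_eq_sum_arcMonomial,
    support_sum_arcMonomial noncrossingMatchings_subset_perfectMatchings]

/-- `NN_n` has exactly as many monomials as there are nest-free perfect matchings of `Fin (2n)`
(that number is the Catalan number `C_n`, Chen–Deng–Du–Stanley–Yan 2007, §1 — not proved in this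
file). [folklore] -/
theorem card_support_nestFreeMatchingPoly [Nontrivial k] :
    (nestFreeMatchingPoly n k).support.card = (nestFreeMatchings (2 * n)).card := by
  rw [nestFreeMatchingPoly_eq_sum_arcMonomial,
    card_support_sum_arcMonomial nestFreeMatchings_subset_perfectMatchings]

/-- `NC_n` has exactly as many monomials as there are noncrossing perfect matchings of
`Fin (2n)`. [folklore] -/
theorem card_support_noncrossingMatchingPoly [Nontrivial k] :
    (noncrossingMatchingPoly n k).support.card = (noncrossingMatchings (2 * n)).card := by
  rw [noncrossingMatchingPoly_eq_sum_arcMonomial,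
    card_support_sum_arcMonomial noncrossingMatchings_subset_perfectMatchings]

/-- **`NN_n` at a `0/1` matrix counts nest-free perfect matchings.** At the `0/1` point of an
edge set `A` (an ordered graph on `Fin (2n)`, edges written `(opener, closer)`), `NN_n` evaluates
to the number of nest-free perfect matchings of `A` (cf. Grytczuk–Pawlik–Ruciński 2025, Prop. 1:
a word is a shuffle square iff its ordered graph has such a matching). [folklore] -/
theorem eval_indicator_nestFreeMatchingPoly (A : Finset (Fin (2 * n) × Fin (2 * n))) :
    eval (fun e => if e ∈ A then (1 : k) else 0) (nestFreeMatchingPoly n k) =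
      (((nestFreeMatchings (2 * n)).filter fun M => ∀ i ∈ openers M, (i, M i) ∈ A).card : k) := by
  rw [nestFreeMatchingPoly_eq_sum_arcMonomial, eval_indicator_sum_arcMonomial]

/-- **`NC_n` at a `0/1` matrix counts noncrossing perfect matchings** of the ordered graph `A`.
[folklore] -/
theorem eval_indicator_noncrossingMatchingPoly (A : Finset (Fin (2 * n) × Fin (2 * n))) :
    eval (fun e => if e ∈ A then (1 : k) else 0) (noncrossingMatchingPoly n k) =
      (((noncrossingMatchings (2 * n)).filter fun M => ∀ i ∈ openers M, (i, M i) ∈ A).card : k) := by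
  rw [noncrossingMatchingPoly_eq_sum_arcMonomial, eval_indicator_sum_arcMonomial]

/-- `NN_n` is homogeneous of degree `n` (every perfect matching of `Fin (2n)` has `n` arcs).
[folklore] -/
theorem nestFreeMatchingPoly_isHomogeneous : (nestFreeMatchingPoly n k).IsHomogeneous n := by
  rw [nestFreeMatchingPoly_eq_sum_arcMonomial]
  exact sum_arcMonomial_isHomogeneous fun M hM =>
    card_openers (nestFreeMatchings_subset_perfectMatchings hM)

/-- `NC_n` is homogeneous of degree `n`. [folklore] -/
theorem noncrossingMatchingPoly_isHomogeneous : (noncrossingMatchingPoly n k).IsHomogeneous n := by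
  rw [noncrossingMatchingPoly_eq_sum_arcMonomial]
  exact sum_arcMonomial_isHomogeneous fun M hM =>
    card_openers (noncrossingMatchings_subset_perfectMatchings hM)

/-- `deg NN_n ≤ n`. [folklore] -/
theorem totalDegree_nestFreeMatchingPoly_le : (nestFreeMatchingPoly n k).totalDegree ≤ n :=
  (nestFreeMatchingPoly_isHomogeneous n (k := k)).totalDegree_le

/-- `deg NC_n ≤ n`. [folklore] -/
theorem totalDegree_noncrossingMatchingPoly_le : (noncrossingMatchingPoly n k).totalDegree ≤ n :=
  (noncrossingMatchingPoly_isHomogeneous n (k := k)).totalDegree_le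

variable (k)

/-- **`(NN_n)_n` is a p-family** (Bürgisser 2000, Def. 2.3): `4 n²` variables and degree `≤ n`.
[cite: Burgisser2000, Def. 2.3] -/
theorem isPFamily_nestFreeMatchingPoly : IsPFamily fun n => nestFreeMatchingPoly n k := by
  refine ⟨(IsPBounded.iff_exists_le_mul_succ_pow _).2 ⟨4, 2, fun m => ?_⟩,
    (IsPBounded.iff_exists_le_mul_succ_pow _).2 ⟨1, 1, fun m => ?_⟩⟩
  · simp only [Fintype.card_prod, Fintype.card_fin]
    nlinarith
  · calc (nestFreeMatchingPoly m k).totalDegree ≤ m := totalDegree_nestFreeMatchingPoly_le m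
      _ ≤ 1 * (m + 1) ^ 1 := by rw [one_mul, pow_one]; exact m.le_succ

/-- **`(NC_n)_n` is a p-family** (Bürgisser 2000, Def. 2.3): `4 n²` variables and degree `≤ n`.
[cite: Burgisser2000, Def. 2.3] -/
theorem isPFamily_noncrossingMatchingPoly : IsPFamily fun n => noncrossingMatchingPoly n k := by
  refine ⟨(IsPBounded.iff_exists_le_mul_succ_pow _).2 ⟨4, 2, fun m => ?_⟩,
    (IsPBounded.iff_exists_le_mul_succ_pow _).2 ⟨1, 1, fun m => ?_⟩⟩
  · simp only [Fintype.card_prod, Fintype.card_fin]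
    nlinarith
  · calc (noncrossingMatchingPoly m k).totalDegree ≤ m := totalDegree_noncrossingMatchingPoly_le m
      _ ≤ 1 * (m + 1) ^ 1 := by rw [one_mul, pow_one]; exact m.le_succ

end API

end Literature.Computability.AlgebraicComplexity

end
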